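import Summits.CriticalPhenomena.PercolationContinuityZ3.Theorems.PercNearOneGluingNoHeavyPcintBSMTail
import HarnessLib

/-!
# PCINT lane, PHASE 9 (block renewal with reach-`m` pieces), step 1: a general symmetric `(2m+1)`-point law

Cell `prim-pcint`, seat `prim-pcint-1` (gen 17); memo `run/shared/lean/prim/pcint/T-FIBRE-ROUTE.md` §PHASE 9.

PHASE 9 runs the block-renewal second moment of PHASES 5–8 (…PcintBSM*, …PcintBSMX*) with transverse pieces of a
general REACH `m` (coordinate-monotone paths with at most `m` steps per axis) whose endpoint law is, coordinate by
coordinate, a general symmetric law on `{-m,…,m}`.  This file is the one-dimensional input, the reach-`m` analogue of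
…PcintBSMXLaw: letters `c : Fin (2m+1)` with values `BSMR.val m c = c - m`, a law `g : Fin (2m+1) → ℝ` that is
nonnegative, sums to one and is symmetric under `Fin.rev` (`BSMR.LawOK`), the `n`-fold convolution `BSMR.H m g n`
(defined by the one-step recursion), its elementary properties (nonnegative, at most one, even, supported on
`|δ| ≤ m n`), and the pair word sums `BSMR.Apair = H (2n)` (the transverse factor of the product formula,
…PcintBSMRGreen).  No dispersion bound is proved here: PHASE 9 bounds the Green tails through the Fourier–Laplace
estimate of …PcintBSMRFourier only.
-/

noncomputable section

namespace Summit.CriticalPhenomena.PercolationContinuityZ3.Theorems.Pcint.BSMR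

open Finset BSM

variable {m : ℕ}

/-! ### The letters and the law -/

/-- The value `c - m ∈ {-m,…,m}` of a letter `c : Fin (2m+1)`. -/
def val (m : ℕ) (c : Fin (2 * m + 1)) : ℤ := (c : ℤ) - m

/-- Reversal negates the value: `val (rev c) = - val c`. -/
theorem val_rev (c : Fin (2 * m + 1)) : val m (Fin.rev c) = -val m c := by
  unfold val
  rw [Fin.val_rev]
  have := c.2
  omega

/-- The values of the letters are at most `m` in absolute value. -/
theorem abs_val_le (c : Fin (2 * m + 1)) : |val m c| ≤ m := by
  unfold val; have := c.2; rw [abs_le]; constructor <;> omega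

/-- **An admissible symmetric law on the letters**: nonnegative, total mass one, invariant under reversal
(`c ↦ 2m - c`, i.e. `v ↦ -v` on values). -/
def LawOK (m : ℕ) (g : Fin (2 * m + 1) → ℝ) : Prop :=
  (∀ c, 0 ≤ g c) ∧ ∑ c, g c = 1 ∧ ∀ c, g (Fin.rev c) = g c

namespace LawOK

variable {g : Fin (2 * m + 1) → ℝ}

/-- The law is nonnegative. -/
theorem nonneg (h : LawOK m g) (c : Fin (2 * m + 1)) : 0 ≤ g c := h.1 c

/-- The law has total mass one. -/
theorem sum_one (h : LawOK m g) : ∑ c, g c = 1 := h.2.1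

/-- The law is symmetric. -/
theorem symm (h : LawOK m g) (c : Fin (2 * m + 1)) : g (Fin.rev c) = g c := h.2.2 c

/-- The law is at most one letterwise. -/
theorem le_one (h : LawOK m g) (c : Fin (2 * m + 1)) : g c ≤ 1 := by
  rw [← h.sum_one]
  exact Finset.single_le_sum (fun c _ => h.nonneg c) (Finset.mem_univ c)

end LawOK

/-! ### The `n`-fold convolution -/

/-- **`H m g n δ`**: the `n`-fold convolution of the law `g` at `δ`, by the one-step recursion. -/
def H (m : ℕ) (g : Fin (2 * m + 1) → ℝ) : ℕ → ℤ → ℝ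
  | 0, δ => if δ = 0 then 1 else 0
  | n + 1, δ => ∑ c : Fin (2 * m + 1), g c * H m g n (δ - val m c)

/-- `H 0 = 𝟙[δ = 0]`. -/
theorem H_zero (g : Fin (2 * m + 1) → ℝ) (δ : ℤ) : H m g 0 δ = if δ = 0 then 1 else 0 := rfl

/-- **The recursion**: `H (n+1) δ = Σ_c g c · H n (δ - val c)`. -/
theorem H_succ (g : Fin (2 * m + 1) → ℝ) (n : ℕ) (δ : ℤ) :
    H m g (n + 1) δ = ∑ c : Fin (2 * m + 1), g c * H m g n (δ - val m c) := rfl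

/-- The reflected form of the recursion (the law is symmetric): `H (n+1) δ = Σ_c g c · H n (δ + val c)`. -/
theorem H_succ' {g : Fin (2 * m + 1) → ℝ} (hg : LawOK m g) (n : ℕ) (δ : ℤ) :
    H m g (n + 1) δ = ∑ c : Fin (2 * m + 1), g c * H m g n (δ + val m c) := by
  rw [H_succ, ← Equiv.sum_comp Fin.revPerm (fun c => g c * H m g n (δ + val m c))]
  refine sum_congr rfl fun c _ => ?_
  simp only [Fin.revPerm_apply, hg.symm, val_rev, ← sub_eq_add_neg]

/-- `H ≥ 0`. -/
theorem H_nonneg {g : Fin (2 * m + 1) → ℝ} (hg : LawOK m g) : ∀ (n : ℕ) (δ : ℤ), 0 ≤ H m g n δ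
  | 0, δ => by rw [H_zero]; split_ifs <;> norm_num
  | n + 1, δ => by
    rw [H_succ]; exact sum_nonneg fun c _ => mul_nonneg (hg.nonneg c) (H_nonneg hg n _)

/-- `H ≤ 1`. -/
theorem H_le_one {g : Fin (2 * m + 1) → ℝ} (hg : LawOK m g) : ∀ (n : ℕ) (δ : ℤ), H m g n δ ≤ 1
  | 0, δ => by rw [H_zero]; split_ifs <;> norm_num
  | n + 1, δ => by
    rw [H_succ]
    calc ∑ c : Fin (2 * m + 1), g c * H m g n (δ - val m c) ≤ ∑ c : Fin (2 * m + 1), g c * 1 :=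
          sum_le_sum fun c _ => mul_le_mul_of_nonneg_left (H_le_one hg n _) (hg.nonneg c)
      _ = 1 := by rw [← sum_mul, hg.sum_one, one_mul]

/-- `H` is even. -/
theorem H_neg {g : Fin (2 * m + 1) → ℝ} (hg : LawOK m g) : ∀ (n : ℕ) (δ : ℤ), H m g n (-δ) = H m g n δ
  | 0, δ => by rw [H_zero, H_zero]; simp only [neg_eq_zero]
  | n + 1, δ => by
    rw [H_succ, H_succ' hg]
    refine sum_congr rfl fun c _ => ?_
    rw [show -δ - val m c = -(δ + val m c) by ring, H_neg hg n]

/-- `H` only depends on `|δ|`. -/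
theorem H_abs {g : Fin (2 * m + 1) → ℝ} (hg : LawOK m g) (n : ℕ) (δ : ℤ) : H m g n |δ| = H m g n δ := by
  rcases le_or_gt 0 δ with h | h
  · rw [abs_of_nonneg h]
  · rw [abs_of_neg h, H_neg hg]

/-- `H n δ = 0` when `|δ| > m n`. -/
theorem H_eq_zero_of_lt (g : Fin (2 * m + 1) → ℝ) : ∀ {n : ℕ} {δ : ℤ}, (m : ℤ) * n < |δ| → H m g n δ = 0
  | 0, δ, h => by
    rw [H_zero]
    have : δ ≠ 0 := by rintro rfl; simp at h
    rw [if_neg this]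
  | n + 1, δ, h => by
    rw [H_succ]
    refine sum_eq_zero fun c _ => ?_
    have hc := abs_val_le (m := m) c
    have : (m : ℤ) * n < |δ - val m c| := by
      have h1 := abs_sub_abs_le_abs_sub δ (val m c)
      push_cast at h
      nlinarith
    rw [H_eq_zero_of_lt g this, mul_zero]

/-! ### Pair word sums -/

/-- Pairs of words: `Apair n δ = Σ_ζ Π_j g(ζ_j.1) g(ζ_j.2) 𝟙[Σ_j (val ζ_j.2 - val ζ_j.1) = δ]`. -/
def Apair (m : ℕ) (g : Fin (2 * m + 1) → ℝ) (n : ℕ) (δ : ℤ) : ℝ :=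
  ∑ ζ : Fin n → Fin (2 * m + 1) × Fin (2 * m + 1), (∏ j, (g (ζ j).1 * g (ζ j).2)) *
    if ∑ j, (val m (ζ j).2 - val m (ζ j).1) = δ then 1 else 0

/-- **`Apair n = H (2n)`** (the difference of two letters is the sum of two letters in law, by symmetry). -/
theorem Apair_eq_H {g : Fin (2 * m + 1) → ℝ} (hg : LawOK m g) : ∀ (n : ℕ) (δ : ℤ), Apair m g n δ = H m g (2 * n) δ
  | 0, δ => by
    rw [Apair, Nat.mul_zero, H_zero, Fintype.sum_unique]
    simp [eq_comm]
  | n + 1, δ => by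
    rw [Apair, BSM.sum_cons, show 2 * (n + 1) = 2 * n + 1 + 1 by ring, H_succ]
    simp_rw [H_succ' hg (2 * n)]
    rw [Fintype.sum_prod_type, sum_comm]
    refine sum_congr rfl fun c' _ => ?_
    rw [mul_sum]
    refine sum_congr rfl fun c _ => ?_
    rw [← Apair_eq_H hg n, Apair, mul_sum, mul_sum]
    refine sum_congr rfl fun ζ _ => ?_
    rw [Fin.prod_univ_succ, Fin.sum_univ_succ]
    simp only [Fin.cons_zero, Fin.cons_succ]
    have : (val m c' - val m c + ∑ j : Fin n, (val m (ζ j).2 - val m (ζ j).1) = δ) ↔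
        (∑ j : Fin n, (val m (ζ j).2 - val m (ζ j).1) = δ - val m c' + val m c) := by
      constructor <;> intro h <;> linarith
    simp only [this]
    ring

/-- `Apair ≥ 0`. -/
theorem Apair_nonneg {g : Fin (2 * m + 1) → ℝ} (hg : LawOK m g) (n : ℕ) (δ : ℤ) : 0 ≤ Apair m g n δ :=
  sum_nonneg fun _ _ => mul_nonneg (prod_nonneg fun _ _ => mul_nonneg (hg.nonneg _) (hg.nonneg _))
    (by split_ifs <;> norm_num)

/-! ### Products over the transverse coordinates -/

variable {t : ℕ}

/-- `Π_l H ≥ 0`. -/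
theorem prod_H_nonneg {g : Fin (2 * m + 1) → ℝ} (hg : LawOK m g) (n : ℕ) (δ : Fin t → ℤ) :
    0 ≤ ∏ l, H m g n (δ l) :=
  prod_nonneg fun _ _ => H_nonneg hg n _

/-- `Π_l H ≤ 1`. -/
theorem prod_H_le_one {g : Fin (2 * m + 1) → ℝ} (hg : LawOK m g) (n : ℕ) (δ : Fin t → ℤ) :
    ∏ l, H m g n (δ l) ≤ 1 :=
  prod_le_one (fun _ _ => H_nonneg hg n _) fun _ _ => H_le_one hg n _

/-- For `t ≥ 2` coordinates, `Π_l H n (δ l) ≤ H n (δ 0) · H n (δ 1)`. -/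
theorem prod_H_le_two {g : Fin (2 * m + 1) → ℝ} (hg : LawOK m g) (ht : 2 ≤ t) (n : ℕ) (δ : Fin t → ℤ) :
    ∏ l, H m g n (δ l) ≤ H m g n (δ ⟨0, by omega⟩) * H m g n (δ ⟨1, by omega⟩) := by
  set i₀ : Fin t := ⟨0, by omega⟩
  set i₁ : Fin t := ⟨1, by omega⟩
  have hne : i₀ ≠ i₁ := by intro h; have := congr_arg Fin.val h; simp [i₀, i₁] at this
  have h0 := fun n l => H_nonneg hg n (δ l)
  have h1 := fun n l => H_le_one hg n (δ l)
  rw [← Finset.prod_mul_prod_compl ({i₀, i₁} : Finset (Fin t)) (fun l => H m g n (δ l)), prod_pair hne]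
  calc H m g n (δ i₀) * H m g n (δ i₁) * ∏ l ∈ ({i₀, i₁} : Finset (Fin t))ᶜ, H m g n (δ l)
      ≤ H m g n (δ i₀) * H m g n (δ i₁) * 1 :=
        mul_le_mul_of_nonneg_left (prod_le_one (fun l _ => h0 n l) fun l _ => h1 n l)
          (mul_nonneg (h0 n i₀) (h0 n i₁))
    _ = _ := mul_one _

/-- The product of the even functions `H n` over the coordinates only depends on `|δ l|`. -/
theorem prod_H_abs {g : Fin (2 * m + 1) → ℝ} (hg : LawOK m g) (n : ℕ) (δ : Fin t → ℤ) :
    ∏ l, H m g n |δ l| = ∏ l, H m g n (δ l) :=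
  prod_congr rfl fun l _ => H_abs hg n (δ l)

end Summit.CriticalPhenomena.PercolationContinuityZ3.Theorems.Pcint.BSMR

end
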